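import Literature.Geometry.Lorentzian.CausalityProofs
import Literature.Geometry.Lorentzian.TimeCones
import Literature.Geometry.Lorentzian.CausalCurveGluing
import Mathlib.Geometry.Manifold.VectorBundle.Hom
import Mathlib.Geometry.Manifold.MFDeriv.Atlas
import Mathlib.Geometry.Manifold.IsManifold.InteriorBoundary
import Mathlib.Algebra.QuadraticDiscriminant
import HarnessLib

/-!
# Transitivity of the causal future `J⁺`: corner rounding of causal curves

This file discharges — in corrected form, see *Discrepancy* below — the named fact
`Literature.Geometry.Lorentzian.LorentzianMetric.causalFuture_trans` of
`Literature.Geometry.Lorentzian.Causality`: **`J⁺(J⁺(S)) = J⁺(S)`** (O'Neill 1983, Ch. 14, p. 402: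
"The relations defined above are transitive"), as the named fact
`LorentzianMetric.causalFuture_causalFuture` together with its proof
`LorentzianMetric.causalFuture_causalFuture_holds` (and its instance `causalFuture_causalFuture_eq`).

## The printed result and what has to be proved here

For O'Neill a causal curve is *piecewise* smooth (Ch. 1, following Def. 1.17: curve segments,
piecewise smooth curves and their breaks; Ch. 5, p. 146: "we require that a piecewise smooth
causal curve does not switch causal cones at a break"), so transitivity of `<` is concatenation.
The vendored `IsFutureCausalCurveOn g τ γ (Icc a b)` instead asks `γ : ℝ → M` to be
differentiable with future causal velocity at *every* parameter of `[a, b]` (two-sidedly at the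
endpoints), so the concatenation of `γ₁ : [a₁, b₁] → M` and `γ₂ : [a₂, b₂] → M` with
`γ₁ b₁ = γ₂ a₂ = p` has to be repaired at the corner `p`
(`LorentzianMetric.exists_isFutureCausalCurveOn_trans`):

* if the two velocities at `p` are proportional, an affine reparametrisation of `γ₂` makes the
  concatenation differentiable at the junction (`IsFutureCausalCurveOn.comp_affine`,
  `IsFutureCausalCurveOn.glue`);
* otherwise their sum `D` is future **timelike** (reverse Cauchy–Schwarz for two future causal
  vectors: `TimeOrientation.IsFutureDirected.val_nonpos` of `Literature.Geometry.Lorentzian.TimeCones`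
  with the equality case `IsFutureDirected.exists_pos_smul_eq_of_val_eq_zero` proved here; O'Neill Ch. 5,
  Lemma 5.29–Prop. 5.30), and in the extended chart `φ` at `p` the corner is replaced by the
  transition–bridge–transition arc of `CausalCurveGluing.corner_rounding_coord`
  (`Literature.Geometry.Lorentzian.CausalCurveGluing`): leave `γ₁` at `A = φ γ₁(b₁ - ε)` bending its
  (possibly null) velocity into the timelike direction `D/2`, cross over on a timelike cubic, and
  symmetrically merge into `γ₂` at `B = φ γ₂(a₂ + ε)`. The estimates need the chart metric to be
  differentiable at `A` and `B` (`C¹` metric, `1 ≤ n`) but neither finite dimension nor the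
  Hausdorff property.

Chart transport: `LorentzianMetric.chartMetric` / `coordMetric` is the metric read in the
trivialization of the bundle of bilinear forms at `p` (Mathlib's `inCoordinates`,
`hom_trivializationAt_apply`), `C¹` on the chart target by `Trivialization.contMDiffOn_section_baseSet_iff`;
`TimeOrientation.chartTime` / `coordTime` likewise; `isFutureDirected_symmL_iff`,
`isFutureDirected_iff_coord` translate causal character, and
`hasDerivAt_extChartAt_comp_continuousLinearMapAt`,
`hasMFDerivAt_extChartAt_symm_comp` move curves through the chart
(`TangentBundle.continuousLinearMapAt_trivializationAt`, `TangentBundle.symmL_trivializationAt`).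

## Discrepancy (why `causalFuture_trans` itself is not discharged)

`causalFuture_trans` is declared in a section with the standing variables
`[FiniteDimensional ℝ E] [T2Space M] [BoundarylessManifold I M]`, but a `def` does not capture
instance-implicit section variables which its body does not mention; as declared it therefore
quantifies over manifolds *with boundary and corners* modelled on an arbitrary convex model range
`range I` (possibly strictly convex) in an arbitrary normed space. This exceeds the source (O'Neill's
manifolds are finite-dimensional, Hausdorff, without boundary) and the method: at a boundary point
of a strictly convex model range a differentiable causal curve is tangent to the boundary and the
rounded arc, which bends by a definite amount, may leave `range I`. The corrected fact
`causalFuture_causalFuture` binds `[BoundarylessManifold I M]` — the one standing hypothesis the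
proof uses — inside the `Prop` and keeps the `2 ≤ n` of the original (the proof uses `1 ≤ n`).
`causalFuture_trans` is left untouched (D-0014).

## References

* B. O'Neill, *Semi-Riemannian geometry with applications to relativity*, Academic Press 1983:
  Ch. 1, following Def. 1.17 (curve segments, piecewise smooth curves); Ch. 5, Lemma 5.26 (p. 141), Lemma 5.29 and
  Prop. 5.30 (pp. 143–144), p. 146 (causal curves, causal cones at breaks); Ch. 10, Lemma 10.45–
  Prop. 10.46 (deforming causal curves to timelike ones); Ch. 14, p. 402 (causality relations,
  transitivity). Key `ONeillSemiRiemannian1983`.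
* S. W. Hawking, G. F. R. Ellis, *The large scale structure of space-time*, CUP 1973, §6.2
  (reparametrisation of causal curves). Key `HawkingEllis1973CUP`.
-/

-- `maxSynthPendingDepth 2`: instance search on the nested operator space `E →L[ℝ] E →L[ℝ] ℝ`
-- (the model fibre of the bundle of bilinear forms) needs one more pending level than the default.
set_option maxSynthPendingDepth 2

noncomputable section

open Bundle Set Filter Function
open scoped Manifold ContDiff Topology

namespace Literature.Geometry.Lorentzian

variable {E : Type*} [NormedAddCommGroup E] [NormedSpace ℝ E] {H : Type*} [TopologicalSpace H]
  {I : ModelWithCorners ℝ E H} {n : ℕ∞ω} {M : Type*} [TopologicalSpace M] [ChartedSpace H M]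
  [IsManifold I ∞ M]

namespace LorentzianMetric

variable (g : LorentzianMetric I n M) {x : M}

/-! ### Timecone algebra at a point: the equality case of the reverse Cauchy–Schwarz inequality

The inequalities themselves (`TimeOrientation.IsFutureDirected.val_nonpos`, `val_lt_zero`,
`TimeOrientation.sq_le_mul_of_orthogonal`, convexity `IsFutureDirected.add`) are in
`Literature.Geometry.Lorentzian.TimeCones` / `ConvergenceTransport`; here we add the equality case
`g(v,w) = 0 ⇒ w = c v` for two future causal vectors, which decides between the two ways of
repairing a corner. -/

/-- The component of `u` orthogonal to a timelike `T` is orthogonal to `T`. [folklore] -/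
lemma val_orthogonalPart {T : TangentSpace I x} (hT : g.IsTimelike T) (u : TangentSpace I x) :
    g.val x T (u - (g.val x T u / g.val x T T) • T) = 0 := by
  have ht : g.val x T T ≠ 0 := hT.ne
  simp only [map_sub, map_smul, smul_eq_mul]
  field_simp
  ring

/-- Decomposition of `g(u,u')` along a timelike vector `T`, multiplied out:
`g(u,u') g(T,T) = g(T,u) g(T,u') + g(u⊥,u'⊥) g(T,T)` (the decomposition `v = a u + v⃗` of O'Neill 1983,
Ch. 5, proof of Lemma 5.29, p. 143). [folklore] -/
lemma val_mul_eq_of_isTimelike {T : TangentSpace I x} (hT : g.IsTimelike T)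
    (u u' : TangentSpace I x) :
    g.val x u u' * g.val x T T =
      g.val x T u * g.val x T u' + g.val x (u - (g.val x T u / g.val x T T) • T)
        (u' - (g.val x T u' / g.val x T T) • T) * g.val x T T := by
  have ht : g.val x T T ≠ 0 := hT.ne
  simp only [map_sub, map_smul, sub_apply, smul_apply, smul_eq_mul, g.symm x u T]
  field_simp
  ring

/-- Real-arithmetic core of the reverse Cauchy–Schwarz inequality for two future-directed
causal vectors, in terms of the scalars `t = g(T,T)`, `α = g(T,v)`, `β = g(T,w)`, the Gram
entries `A, B, C` of the orthogonal parts and `P = g(v,v)`, `Q = g(w,w)`, `R = g(v,w)`. [folklore] -/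
lemma reverseCauchySchwarz_aux {t α β A B C P Q R : ℝ} (ht : t < 0) (hα : α < 0) (hβ : β < 0)
    (hA : 0 ≤ A) (hB : 0 ≤ B) (hCS : C ^ 2 ≤ A * B) (hP : P ≤ 0) (hQ : Q ≤ 0)
    (hva : P * t = α * α + A * t) (hwb : Q * t = β * β + B * t) (hvw : R * t = α * β + C * t) :
    R ≤ 0 ∧ (R = 0 → A * (-t) = α ^ 2 ∧ B * (-t) = β ^ 2 ∧ C * (-t) = α * β) := by
  have h1 : A * (-t) ≤ α ^ 2 := by nlinarith
  have h2 : B * (-t) ≤ β ^ 2 := by nlinarith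
  have hA' : 0 ≤ A * (-t) := mul_nonneg hA (neg_pos.mpr ht).le
  have hB' : 0 ≤ B * (-t) := mul_nonneg hB (neg_pos.mpr ht).le
  have h' : (C * (-t)) ^ 2 ≤ (A * (-t)) * (B * (-t)) := by
    nlinarith [hCS, mul_pos (neg_pos.mpr ht) (neg_pos.mpr ht)]
  have h3 : (C * (-t)) ^ 2 ≤ (α * β) ^ 2 := by
    nlinarith [h', mul_le_mul h1 h2 hB' (sq_nonneg α)]
  have hαβ : 0 < α * β := mul_pos_of_neg_of_neg hα hβ
  have h4 : C * (-t) ≤ α * β := (abs_le_of_sq_le_sq' h3 hαβ.le).2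
  refine ⟨by nlinarith [hvw, h4], fun hR ↦ ?_⟩
  have h5 : C * (-t) = α * β := by
    have : R * t = 0 := by rw [hR, zero_mul]
    nlinarith [hvw, this]
  have h6 : (A * (-t)) * (B * (-t)) = α ^ 2 * β ^ 2 := by
    apply le_antisymm
    · nlinarith [mul_le_mul h1 h2 hB' (sq_nonneg α)]
    · nlinarith [h', h5]
  have h7 : A * (-t) = α ^ 2 := by
    by_contra hne
    have hlt : A * (-t) < α ^ 2 := lt_of_le_of_ne h1 hne
    have : (A * (-t)) * (B * (-t)) < α ^ 2 * β ^ 2 := by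
      have hβ2 : 0 < β ^ 2 := by nlinarith [mul_pos_of_neg_of_neg hβ hβ]
      calc (A * (-t)) * (B * (-t)) ≤ (A * (-t)) * β ^ 2 := by gcongr
        _ < α ^ 2 * β ^ 2 := mul_lt_mul_of_pos_right hlt hβ2
    exact this.ne h6
  have h8 : B * (-t) = β ^ 2 := by
    by_contra hne
    have hlt : B * (-t) < β ^ 2 := lt_of_le_of_ne h2 hne
    have : (A * (-t)) * (B * (-t)) < α ^ 2 * β ^ 2 := by
      have hα2 : 0 < α ^ 2 := by nlinarith [mul_pos_of_neg_of_neg hα hα]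
      calc (A * (-t)) * (B * (-t)) ≤ α ^ 2 * (B * (-t)) := by gcongr
        _ < α ^ 2 * β ^ 2 := mul_lt_mul_of_pos_left hlt hα2
    exact this.ne h6
  exact ⟨h7, h8, h5⟩

variable {g} {τ : TimeOrientation g}

/-- **Equality in the reverse Cauchy–Schwarz inequality for timecones.** Two future-directed
causal vectors `v, w` with `g(v,w) = 0` are proportional, `w = c v` with `c > 0` (and then both
are null): equality forces equality in the Schwarz inequality for the orthogonal parts, which are
therefore proportional by positive definiteness of `g` on `τ_x^⊥`. O'Neill 1983, Ch. 5, Prop. 5.30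
(1) ("with equality if and only if `v` and `w` are collinear", timelike case) and p. 144 (causal
cones); Hawking–Ellis 1973, §2.4. [cite: ONeillSemiRiemannian1983, Ch. 5, Prop. 5.30 (p. 144)] -/
theorem _root_.Literature.Geometry.Lorentzian.TimeOrientation.IsFutureDirected.exists_pos_smul_eq_of_val_eq_zero
    {v w : TangentSpace I x} (hv : τ.IsFutureDirected v) (hw : τ.IsFutureDirected w)
    (h0 : g.val x v w = 0) : ∃ c : ℝ, 0 < c ∧ w = c • v := by
  set T := τ.vectorField x with hTdef
  have hT : g.IsTimelike T := τ.isTimelike x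
  have ht : g.val x T T < 0 := hT
  have hα : g.val x T v < 0 := hv.2
  have hβ : g.val x T w < 0 := hw.2
  have ha := g.val_orthogonalPart hT v
  have hb := g.val_orthogonalPart hT w
  have hCS := τ.sq_le_mul_of_orthogonal ha hb
  have haa := τ.nonneg_of_orthogonal ha
  have hbb := τ.nonneg_of_orthogonal hb
  obtain ⟨-, heq⟩ := reverseCauchySchwarz_aux ht hα hβ haa hbb hCS hv.1.1 hw.1.1
    (g.val_mul_eq_of_isTimelike hT v v) (g.val_mul_eq_of_isTimelike hT w w)
    (g.val_mul_eq_of_isTimelike hT v w)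
  obtain ⟨hA, hB, hC⟩ := heq h0
  -- the orthogonal parts `a, b` of `v, w` satisfy `β a = α b`
  set α := g.val x T v with hαdef
  set β := g.val x T w with hβdef
  set t := g.val x T T with htdef
  set a := v - (α / t) • T with hadef
  set b := w - (β / t) • T with hbdef
  have hz : g.val x T (β • a - α • b) = 0 := by
    simp only [map_sub, map_smul, smul_eq_mul, ha, hb, mul_zero, sub_zero]
  have hQ : g.val x (β • a - α • b) (β • a - α • b) * (-t) =
      β ^ 2 * (g.val x a a * (-t)) - 2 * α * β * (g.val x a b * (-t))
        + α ^ 2 * (g.val x b b * (-t)) := by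
    simp only [map_sub, map_smul, sub_apply, smul_apply, smul_eq_mul, g.symm x b a]
    ring
  rw [hA, hB, hC] at hQ
  have hQ0 : g.val x (β • a - α • b) (β • a - α • b) = 0 := by
    have htne : (-t) ≠ 0 := (neg_pos.mpr ht).ne'
    have : g.val x (β • a - α • b) (β • a - α • b) * (-t) = 0 := by rw [hQ]; ring
    exact (mul_eq_zero.mp this).resolve_right htne
  have hab : β • a - α • b = 0 := by
    by_contra hne
    exact (g.pos_of_orthogonal x T _ hT hz hne).ne' hQ0
  have hvw : β • v - α • w = 0 := by
    have : β • v - α • w = β • a - α • b := by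
      simp only [hadef, hbdef, smul_sub, smul_smul]
      have htne : t ≠ 0 := ht.ne
      field_simp
      ring_nf
      abel
    rw [this, hab]
  refine ⟨β / α, div_pos_of_neg_of_neg hβ hα, ?_⟩
  have hαne : α ≠ 0 := hα.ne
  have : α • w = β • v := (sub_eq_zero.mp hvw).symm
  calc w = α⁻¹ • (α • w) := by rw [smul_smul, inv_mul_cancel₀ hαne, one_smul]
    _ = (β / α) • v := by rw [this, smul_smul, div_eq_inv_mul]

/-- The sum of two non-proportional future-directed causal vectors is future-directed
**timelike** (for `IsFutureDirected (v + w)` itself see `TimeOrientation.IsFutureDirected.add`).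
O'Neill 1983, Ch. 5, Lemma 5.29 and p. 144. [cite: ONeillSemiRiemannian1983, Ch. 5, Prop. 5.30 (p. 144)] -/
theorem _root_.Literature.Geometry.Lorentzian.TimeOrientation.IsFutureDirected.isTimelike_add
    {v w : TangentSpace I x} (hv : τ.IsFutureDirected v) (hw : τ.IsFutureDirected w)
    (hne : ¬ ∃ c : ℝ, 0 < c ∧ w = c • v) : g.IsTimelike (v + w) := by
  have hle := hv.val_nonpos τ hw
  have hlt : g.val x v w < 0 :=
    lt_of_le_of_ne hle fun h ↦ hne (hv.exists_pos_smul_eq_of_val_eq_zero hw h)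
  have hwv : g.val x w v < 0 := by rwa [g.symm]
  have := hv.1.1; have := hw.1.1
  show g.val x (v + w) (v + w) < 0
  simp only [map_add, add_apply]
  linarith

end LorentzianMetric

/-! ### The metric and the time orientation in a chart -/

namespace LorentzianMetric

variable (g : LorentzianMetric I n M)

/-- The metric read in the trivialization of the bundle of bilinear forms at `p`, as a function
of the point `y ∈ M`: `(v, w) ↦ g_y(ψ_y v, ψ_y w)` with `ψ_y` the inverse tangent trivialization
at `p` (`chartMetric_apply`). [folklore] -/
def chartMetric (p y : M) : E →L[ℝ] E →L[ℝ] ℝ :=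
  ContinuousLinearMap.inCoordinates E (TangentSpace I) (E →L[ℝ] ℝ)
    (fun x ↦ TangentSpace I x →L[ℝ] ℝ) p y p y (g.val y)

/-- The coordinate expression of a `C¹` metric is `C¹` on the chart domain (smoothness of a
section read in a fixed trivialization, `Trivialization.contMDiffOn_section_baseSet_iff`).
[folklore] -/
lemma contMDiffOn_chartMetric (hn : 1 ≤ n) (p : M) :
    ContMDiffOn I 𝓘(ℝ, E →L[ℝ] E →L[ℝ] ℝ) 1 (g.chartMetric p) (chartAt H p).source := by
  set e := trivializationAt (E →L[ℝ] E →L[ℝ] ℝ)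
      (fun b : M ↦ TangentSpace I b →L[ℝ] TangentSpace I b →L[ℝ] ℝ) p with he
  have hb : e.baseSet = (chartAt H p).source := by simp [e]
  have h := (g.contMDiff.of_le hn).contMDiffOn (s := e.baseSet)
  rw [e.contMDiffOn_section_baseSet_iff, hb] at h
  exact h

/-- Evaluation of `chartMetric`. [folklore] -/
lemma chartMetric_apply {p y : M} (hy : y ∈ (chartAt H p).source) (v w : E) :
    g.chartMetric p y v w =
      g.val y ((trivializationAt E (TangentSpace I) p).symmL ℝ y v)
        ((trivializationAt E (TangentSpace I) p).symmL ℝ y w) := by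
  have hy' : y ∈ (trivializationAt E (TangentSpace I) p).baseSet := by simpa using hy
  unfold chartMetric
  rw [inCoordinates_apply_eq₂ hy' hy' (mem_univ _), Trivialization.symmL_apply _ hy',
    Trivialization.symmL_apply _ hy']
  simp

/-- The metric in the coordinates of the extended chart at `p`: a field of bilinear forms on the
model space `E`, `x ↦ chartMetric g p (φ⁻¹ x)`. [folklore] -/
def coordMetric (p : M) (x : E) : E →L[ℝ] E →L[ℝ] ℝ :=
  g.chartMetric p ((extChartAt I p).symm x)

/-- The coordinate expression of a `C¹` metric is `C¹` on the chart target. [folklore] -/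
lemma contDiffOn_coordMetric (hn : 1 ≤ n) (p : M) :
    ContDiffOn ℝ 1 (g.coordMetric p) (extChartAt I p).target := by
  rw [← contMDiffOn_iff_contDiffOn]
  refine (g.contMDiffOn_chartMetric hn p).comp (contMDiffOn_extChartAt_symm p) fun x hx ↦ ?_
  rw [← extChartAt_source I p]
  exact (extChartAt I p).map_target hx

/-- Evaluation of `coordMetric` at a point of the chart target. [folklore] -/
lemma coordMetric_apply {p : M} {x : E} (hx : x ∈ (extChartAt I p).target) (v w : E) :
    g.coordMetric p x v w =
      g.val ((extChartAt I p).symm x)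
        ((trivializationAt E (TangentSpace I) p).symmL ℝ ((extChartAt I p).symm x) v)
        ((trivializationAt E (TangentSpace I) p).symmL ℝ ((extChartAt I p).symm x) w) := by
  have hy : (extChartAt I p).symm x ∈ (chartAt H p).source := by
    rw [← extChartAt_source I p]; exact (extChartAt I p).map_target hx
  exact g.chartMetric_apply hy v w

/-- The coordinate metric is symmetric. [folklore] -/
lemma coordMetric_comm {p : M} {x : E} (hx : x ∈ (extChartAt I p).target) (v w : E) :
    g.coordMetric p x v w = g.coordMetric p x w v := by
  rw [g.coordMetric_apply hx, g.coordMetric_apply hx, g.symm]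

end LorentzianMetric

namespace TimeOrientation

variable {g : LorentzianMetric I n M} (τ : TimeOrientation g)

/-- The orienting vector field read in the tangent trivialization at `p`, as a function of the
point `y ∈ M`. [folklore] -/
def chartTime (p y : M) : E :=
  (trivializationAt E (TangentSpace I) p ⟨y, τ.vectorField y⟩).2

/-- The coordinate expression of a `C¹` time orientation is `C¹` on the chart domain. [folklore] -/
lemma contMDiffOn_chartTime (hn : 1 ≤ n) (p : M) :
    ContMDiffOn I 𝓘(ℝ, E) 1 (τ.chartTime p) (chartAt H p).source := by
  set e := trivializationAt E (TangentSpace I) p with he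
  have hb : e.baseSet = (chartAt H p).source := by simp [e]
  have h := (τ.contMDiff.of_le hn).contMDiffOn (s := e.baseSet)
  rw [e.contMDiffOn_section_baseSet_iff, hb] at h
  exact h

/-- Evaluation of `chartTime`. [folklore] -/
lemma chartTime_apply {p y : M} (hy : y ∈ (chartAt H p).source) :
    τ.chartTime p y =
      (trivializationAt E (TangentSpace I) p).continuousLinearMapAt ℝ y (τ.vectorField y) := by
  have hy' : y ∈ (trivializationAt E (TangentSpace I) p).baseSet := by simpa using hy
  rw [Trivialization.continuousLinearMapAt_apply_of_mem ℝ _ hy']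
  rfl

/-- The time orientation in the coordinates of the extended chart at `p`. [folklore] -/
def coordTime (p : M) (x : E) : E :=
  τ.chartTime p ((extChartAt I p).symm x)

/-- The coordinate expression of the time orientation is continuous on the chart target. [folklore] -/
lemma continuousOn_coordTime (hn : 1 ≤ n) (p : M) :
    ContinuousOn (τ.coordTime p) (extChartAt I p).target := by
  have h : ContMDiffOn 𝓘(ℝ, E) 𝓘(ℝ, E) 1 (τ.coordTime p) (extChartAt I p).target := by
    refine (τ.contMDiffOn_chartTime hn p).comp (contMDiffOn_extChartAt_symm p) fun x hx ↦ ?_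
    rw [← extChartAt_source I p]
    exact (extChartAt I p).map_target hx
  exact h.continuousOn

/-- Evaluation of `coordTime` at a point of the chart target. [folklore] -/
lemma coordTime_apply {p : M} {x : E} (hx : x ∈ (extChartAt I p).target) :
    τ.coordTime p x = (trivializationAt E (TangentSpace I) p).continuousLinearMapAt ℝ
      ((extChartAt I p).symm x) (τ.vectorField ((extChartAt I p).symm x)) := by
  have hy : (extChartAt I p).symm x ∈ (chartAt H p).source := by
    rw [← extChartAt_source I p]; exact (extChartAt I p).map_target hx
  exact τ.chartTime_apply hy

end TimeOrientation

/-! ### Causal character in coordinates -/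

section CoordCausal

variable {g : LorentzianMetric I n M} {τ : TimeOrientation g} {p : M}

/-- Shorthand used in statements: the tangent trivialization at `p`. -/
local notation "eT" => trivializationAt E (TangentSpace I) p

/-- In the chart at `p`, a tangent vector `u` at `y = φ⁻¹ x` with coordinate image `û` has
`Ĝ_x(û, û) = g_y(u, u)`. [folklore] -/
lemma coordMetric_apply_continuousLinearMapAt {x : E} (hx : x ∈ (extChartAt I p).target)
    (u u' : TangentSpace I ((extChartAt I p).symm x)) :
    g.coordMetric p x ((eT).continuousLinearMapAt ℝ _ u) ((eT).continuousLinearMapAt ℝ _ u') =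
      g.val ((extChartAt I p).symm x) u u' := by
  have hy : (extChartAt I p).symm x ∈ (eT).baseSet := by
    simp only [TangentBundle.trivializationAt_baseSet, ← extChartAt_source I p]
    exact (extChartAt I p).map_target hx
  rw [g.coordMetric_apply hx, Trivialization.symmL_continuousLinearMapAt _ hy,
    Trivialization.symmL_continuousLinearMapAt _ hy]

/-- In the chart at `p`: `Ĝ_x(T̂_x, û) = g_y(T_y, u)`. [folklore] -/
lemma coordMetric_coordTime_continuousLinearMapAt {x : E} (hx : x ∈ (extChartAt I p).target)
    (u : TangentSpace I ((extChartAt I p).symm x)) :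
    g.coordMetric p x (τ.coordTime p x) ((eT).continuousLinearMapAt ℝ _ u) =
      g.val ((extChartAt I p).symm x) (τ.vectorField _) u := by
  rw [τ.coordTime_apply hx, coordMetric_apply_continuousLinearMapAt hx]

/-- In the chart at `p`: `Ĝ_x(T̂_x, v) = g_y(T_y, ψ_y v)`. [folklore] -/
lemma coordMetric_coordTime_apply {x : E} (hx : x ∈ (extChartAt I p).target) (v : E) :
    g.coordMetric p x (τ.coordTime p x) v =
      g.val ((extChartAt I p).symm x) (τ.vectorField _) ((eT).symmL ℝ _ v) := by
  have hy : (extChartAt I p).symm x ∈ (eT).baseSet := by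
    simp only [TangentBundle.trivializationAt_baseSet, ← extChartAt_source I p]
    exact (extChartAt I p).map_target hx
  conv_lhs => rw [← (eT).continuousLinearMapAt_symmL (R := ℝ) hy v]
  exact coordMetric_coordTime_continuousLinearMapAt hx _

/-- **Future-directedness in coordinates**: `ψ_y v` is future-directed causal at `y = φ⁻¹ x` iff
`Ĝ_x(v,v) ≤ 0`, `v ≠ 0` and `Ĝ_x(T̂_x, v) < 0`. [folklore] -/
lemma isFutureDirected_symmL_iff {x : E} (hx : x ∈ (extChartAt I p).target) (v : E) :
    τ.IsFutureDirected ((eT).symmL ℝ ((extChartAt I p).symm x) v) ↔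
      (g.coordMetric p x v v ≤ 0 ∧ v ≠ 0) ∧ g.coordMetric p x (τ.coordTime p x) v < 0 := by
  have hy : (extChartAt I p).symm x ∈ (eT).baseSet := by
    simp only [TangentBundle.trivializationAt_baseSet, ← extChartAt_source I p]
    exact (extChartAt I p).map_target hx
  rw [TimeOrientation.isFutureDirected_iff, LorentzianMetric.isCausal_iff, g.coordMetric_apply hx,
    coordMetric_coordTime_apply hx]
  have hne : (eT).symmL ℝ ((extChartAt I p).symm x) v ≠ 0 ↔ v ≠ 0 := by
    refine not_congr ⟨fun h ↦ ?_, fun h ↦ by rw [h, map_zero]⟩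
    have := congrArg ((eT).continuousLinearMapAt ℝ ((extChartAt I p).symm x)) h
    rwa [(eT).continuousLinearMapAt_symmL hy, map_zero] at this
  rw [hne]

/-- **Timelikeness in coordinates**: `ψ_y v` is timelike iff `Ĝ_x(v,v) < 0`. [folklore] -/
lemma isTimelike_symmL_iff {x : E} (hx : x ∈ (extChartAt I p).target) (v : E) :
    g.IsTimelike ((eT).symmL ℝ ((extChartAt I p).symm x) v) ↔ g.coordMetric p x v v < 0 := by
  rw [LorentzianMetric.isTimelike_iff, g.coordMetric_apply hx]

end CoordCausal

/-! ### Curves through the chart -/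

section CoordCurves

variable {p : M}

local notation "eT" => trivializationAt E (TangentSpace I) p

/-- **Curves read in a chart.** If `γ` is differentiable at `t` and `γ t` lies in the chart domain
of `p`, then `φ ∘ γ` has derivative `dφ(γ'(t))` at `t`, i.e. the coordinate image of the velocity
under the tangent trivialization at `p`. [folklore] -/
lemma hasDerivAt_extChartAt_comp_continuousLinearMapAt {γ : ℝ → M} {t : ℝ} (hγ : MDifferentiableAt 𝓘(ℝ, ℝ) I γ t)
    (ht : γ t ∈ (chartAt H p).source) :
    HasDerivAt (extChartAt I p ∘ γ)
      ((eT).continuousLinearMapAt ℝ (γ t) (velocity I γ t)) t := by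
  have h1 := (mdifferentiableAt_extChartAt ht).hasMFDerivAt.comp t hγ.hasMFDerivAt
  have hd : DifferentiableAt ℝ (extChartAt I p ∘ γ) t :=
    mdifferentiableAt_iff_differentiableAt.mp h1.mdifferentiableAt
  have h2 : deriv (extChartAt I p ∘ γ) t =
      (eT).continuousLinearMapAt ℝ (γ t) (velocity I γ t) := by
    rw [TangentBundle.continuousLinearMapAt_trivializationAt ht, ← fderiv_apply_one_eq_deriv, ← mfderiv_eq_fderiv,
      h1.mfderiv]
    rfl
  exact h2 ▸ hd.hasDerivAt

/-- **Coordinate curves mapped into the manifold.** If `c : ℝ → E` has derivative `u` at `t` and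
stays in the chart target near `t`, then `φ⁻¹ ∘ c` is differentiable at `t` with velocity
`ψ (u)`, the inverse tangent trivialization applied to `u`. [folklore] -/
lemma hasMFDerivAt_extChartAt_symm_comp {c : ℝ → E} {u : E} {t : ℝ} (hc : HasDerivAt c u t)
    (hmem : ∀ᶠ s in 𝓝 t, c s ∈ (extChartAt I p).target) :
    MDifferentiableAt 𝓘(ℝ, ℝ) I ((extChartAt I p).symm ∘ c) t ∧
      velocity I ((extChartAt I p).symm ∘ c) t =
        (eT).symmL ℝ ((extChartAt I p).symm (c t)) u := by
  have hct : c t ∈ (extChartAt I p).target := hmem.self_of_nhds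
  have hy : (extChartAt I p).symm (c t) ∈ (chartAt H p).source := by
    rw [← extChartAt_source I p]; exact (extChartAt I p).map_target hct
  have h1 := (mdifferentiableWithinAt_extChartAt_symm hct).hasMFDerivWithinAt
  have h2 : HasMFDerivAt 𝓘(ℝ, ℝ) 𝓘(ℝ, E) c t (ContinuousLinearMap.toSpanSingleton ℝ u) :=
    hasMFDerivAt_iff_hasFDerivAt.mpr hc.hasFDerivAt
  have h3 := h1.comp t (h2.hasMFDerivWithinAt (s := c ⁻¹' (extChartAt I p).target))
    (fun s hs ↦ extChartAt_target_subset_range p hs)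
  have h4 := h3.hasMFDerivAt hmem
  refine ⟨h4.mdifferentiableAt, ?_⟩
  have h5 : ContinuousLinearMap.toSpanSingleton ℝ u (1 : ℝ) = u := by
    rw [ContinuousLinearMap.toSpanSingleton_apply, one_smul]
  unfold velocity
  rw [h4.mfderiv, TangentBundle.symmL_trivializationAt hy, (extChartAt I p).right_inv hct]
  exact congrArg (mfderivWithin 𝓘(ℝ, E) I (extChartAt I p).symm (range I) (c t)) h5

end CoordCurves

/-! ### Causal character in coordinates at a point of the chart domain -/

section CoordCausalPoint

variable {g : LorentzianMetric I n M} {τ : TimeOrientation g} {p : M}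

local notation "eT" => trivializationAt E (TangentSpace I) p

/-- **Future-directedness in coordinates** (point version): for `y` in the chart domain of `p`
and `u ∈ T_y M` with coordinate image `û = dφ_y u`, `u` is future-directed causal iff
`Ĝ(û, û) ≤ 0`, `û ≠ 0` and `Ĝ(T̂, û) < 0` at `x = φ y`. [folklore] -/
lemma isFutureDirected_iff_coord {y : M} (hy : y ∈ (chartAt H p).source) (u : TangentSpace I y) :
    τ.IsFutureDirected u ↔
      (g.coordMetric p (extChartAt I p y) ((eT).continuousLinearMapAt ℝ y u)
          ((eT).continuousLinearMapAt ℝ y u) ≤ 0 ∧ (eT).continuousLinearMapAt ℝ y u ≠ 0) ∧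
      g.coordMetric p (extChartAt I p y) (τ.coordTime p (extChartAt I p y))
          ((eT).continuousLinearMapAt ℝ y u) < 0 := by
  have hy' : y ∈ (extChartAt I p).source := by rwa [extChartAt_source]
  have hx : extChartAt I p y ∈ (extChartAt I p).target := (extChartAt I p).map_source hy'
  have hb : y ∈ (eT).baseSet := by simpa using hy
  have key := isFutureDirected_symmL_iff (τ := τ) hx ((eT).continuousLinearMapAt ℝ y u)
  rw [(extChartAt I p).left_inv hy', (eT).symmL_continuousLinearMapAt hb] at key
  exact key

/-- **Timelikeness in coordinates** (point version). [folklore] -/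
lemma isTimelike_iff_coord {y : M} (hy : y ∈ (chartAt H p).source) (u : TangentSpace I y) :
    g.IsTimelike u ↔
      g.coordMetric p (extChartAt I p y) ((eT).continuousLinearMapAt ℝ y u)
          ((eT).continuousLinearMapAt ℝ y u) < 0 := by
  have hy' : y ∈ (extChartAt I p).source := by rwa [extChartAt_source]
  have hx : extChartAt I p y ∈ (extChartAt I p).target := (extChartAt I p).map_source hy'
  have hb : y ∈ (eT).baseSet := by simpa using hy
  have key := isTimelike_symmL_iff (g := g) hx ((eT).continuousLinearMapAt ℝ y u)
  rw [(extChartAt I p).left_inv hy', (eT).symmL_continuousLinearMapAt hb] at key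
  exact key

/-- The coordinate metric evaluated on coordinate images of tangent vectors at `y`. [folklore] -/
lemma coordMetric_extChartAt_apply {y : M} (hy : y ∈ (chartAt H p).source)
    (u u' : TangentSpace I y) :
    g.coordMetric p (extChartAt I p y) ((eT).continuousLinearMapAt ℝ y u)
        ((eT).continuousLinearMapAt ℝ y u') = g.val y u u' := by
  have hy' : y ∈ (extChartAt I p).source := by rwa [extChartAt_source]
  have hx : extChartAt I p y ∈ (extChartAt I p).target := (extChartAt I p).map_source hy'
  have key := coordMetric_apply_continuousLinearMapAt (g := g) hx
  rw [(extChartAt I p).left_inv hy'] at key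
  exact key u u'

end CoordCausalPoint

/-! ### From coordinate curves to causal curves -/

section CoordToManifold

variable {g : LorentzianMetric I n M} {τ : TimeOrientation g} {p : M}

/-- **A good coordinate curve is a causal curve.** If `c : ℝ → E` is differentiable at every
parameter of `[s₀, s₁]` with velocity `u s`, stays in an open subset `U` of the chart target, and
`(c s, u s)` satisfies the coordinate conditions of future-directed causality, then `φ⁻¹ ∘ c` is a
future-directed causal curve on `[s₀, s₁]`. [folklore] -/
theorem isFutureCausalCurveOn_extChartAt_symm_comp {U : Set E} (hU : IsOpen U)
    (hUt : U ⊆ (extChartAt I p).target) {c u : ℝ → E} {s₀ s₁ : ℝ}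
    (h : ∀ s ∈ Icc s₀ s₁, HasDerivAt c (u s) s ∧ c s ∈ U ∧
      (g.coordMetric p (c s) (u s) (u s) ≤ 0 ∧ u s ≠ 0) ∧
      g.coordMetric p (c s) (τ.coordTime p (c s)) (u s) < 0) :
    g.IsFutureCausalCurveOn τ ((extChartAt I p).symm ∘ c) (Icc s₀ s₁) := by
  intro s hs
  obtain ⟨hd, hcU, hcausal⟩ := h s hs
  have hmem : ∀ᶠ s' in 𝓝 s, c s' ∈ (extChartAt I p).target :=
    (hd.continuousAt.eventually (hU.mem_nhds hcU)).mono fun s' hs' ↦ hUt hs'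
  obtain ⟨hmd, hvel⟩ := hasMFDerivAt_extChartAt_symm_comp (p := p) hd hmem
  refine ⟨hmd, ?_⟩
  rw [hvel]
  exact (isFutureDirected_symmL_iff (hUt hcU) (u s)).mpr hcausal

end CoordToManifold

/-! ### Reparametrisation and gluing of causal curves -/

namespace LorentzianMetric

variable {g : LorentzianMetric I n M} {τ : TimeOrientation g}

/-- **Reparametrisation of causal curves.** If `γ` is a future causal curve on `s` and `φ` is
differentiable with positive derivative, then `γ ∘ φ` is a future causal curve on `φ ⁻¹' s`.
Hawking–Ellis 1973, §6.2, p. 184. [cite: HawkingEllis1973CUP, §6.2, p. 184] -/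
lemma IsFutureCausalCurveOn.comp_of_hasDerivAt {γ : ℝ → M} {s : Set ℝ}
    (hγ : g.IsFutureCausalCurveOn τ γ s) {φ φ' : ℝ → ℝ} (hφ : ∀ u, HasDerivAt φ (φ' u) u)
    (hpos : ∀ u, 0 < φ' u) : g.IsFutureCausalCurveOn τ (γ ∘ φ) (φ ⁻¹' s) := by
  intro u hu
  obtain ⟨hd, hf⟩ := hγ (φ u) hu
  have h1 : HasMFDerivAt 𝓘(ℝ, ℝ) 𝓘(ℝ, ℝ) φ u (ContinuousLinearMap.toSpanSingleton ℝ (φ' u)) :=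
    hasMFDerivAt_iff_hasFDerivAt.mpr (hφ u).hasFDerivAt
  have h2 := hd.hasMFDerivAt.comp u h1
  have hv : velocity I (γ ∘ φ) u = φ' u • velocity I γ (φ u) := by
    have h3 : ContinuousLinearMap.toSpanSingleton ℝ (φ' u) (1 : ℝ) = φ' u • (1 : ℝ) := by
      rw [ContinuousLinearMap.toSpanSingleton_apply, smul_eq_mul, smul_eq_mul, mul_comm]
    unfold velocity
    rw [h2.mfderiv]
    exact (congrArg (mfderiv 𝓘(ℝ, ℝ) I γ (φ u)) h3).trans (map_smul _ _ _)
  refine ⟨h2.mdifferentiableAt, ?_⟩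
  rw [hv]; exact hf.smul (hpos u)

/-- Shift of the parameter: `s ↦ γ (s + c)` is future causal on `[a - c, b - c]`. [folklore] -/
lemma IsFutureCausalCurveOn.comp_add_const {γ : ℝ → M} {a b : ℝ}
    (hγ : g.IsFutureCausalCurveOn τ γ (Icc a b)) (c : ℝ) :
    g.IsFutureCausalCurveOn τ (fun s ↦ γ (s + c)) (Icc (a - c) (b - c)) := by
  have h := hγ.comp_of_hasDerivAt (φ := fun s ↦ s + c) (φ' := fun _ ↦ 1)
    (fun u ↦ (hasDerivAt_id u).add_const c) (fun _ ↦ one_pos)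
  rw [Set.preimage_add_const_Icc] at h
  exact h

/-- Affine reparametrisation with positive slope: `s ↦ γ (c + s / k)`, `k > 0`, is future causal
at every `s` with `c + s / k ∈ [a, b]`. [folklore] -/
lemma IsFutureCausalCurveOn.comp_affine {γ : ℝ → M} {a b : ℝ}
    (hγ : g.IsFutureCausalCurveOn τ γ (Icc a b)) (c : ℝ) {k : ℝ} (hk : 0 < k) {t : Set ℝ}
    (ht : ∀ s ∈ t, c + s / k ∈ Icc a b) :
    g.IsFutureCausalCurveOn τ (fun s ↦ γ (c + s / k)) t := by
  have h := hγ.comp_of_hasDerivAt (φ := fun s ↦ c + s / k) (φ' := fun _ ↦ 1 / k)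
    (fun u ↦ by simpa using ((hasDerivAt_id u).div_const k).const_add c) (fun _ ↦ by positivity)
  exact fun s hs ↦ h s (ht s hs)

/-- Transfer of future-directedness along an equality of base points and of (coordinate-free)
vectors; uses the definitional equality `TangentSpace I y = E`. [folklore] -/
lemma isFutureDirected_congr_point {y y' : M} (h : y = y') {u : TangentSpace I y}
    {u' : TangentSpace I y'} (huu : (u : E) = u') :
    τ.IsFutureDirected u ↔ τ.IsFutureDirected u' := by
  subst h
  have : u = u' := huu
  rw [this]

/-- **Gluing causal curves which overlap differentiably.** Let `γ₁` be future causal on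
`[a, σ₀]`, `m` on `[σ₀, σ₁]`, `γ₂` on `[σ₁, b]`, and suppose `m` *coincides* with `γ₁` on a left
neighbourhood `(σ₀ - δ, σ₀]` of `σ₀` and with `γ₂` on a right neighbourhood `(σ₁, σ₁ + δ)` of `σ₁`
(so that the junctions are interior points of a single differentiable piece). Then the glued curve
is future causal on `[a, b]`. [folklore] -/
theorem IsFutureCausalCurveOn.glue {γ₁ m γ₂ : ℝ → M} {a σ₀ σ₁ b δ : ℝ}
    (hσ : σ₀ ≤ σ₁) (hδ : 0 < δ)
    (h₁ : g.IsFutureCausalCurveOn τ γ₁ (Icc a σ₀)) (hm : g.IsFutureCausalCurveOn τ m (Icc σ₀ σ₁))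
    (h₂ : g.IsFutureCausalCurveOn τ γ₂ (Icc σ₁ b))
    (hleft : ∀ s ∈ Ioc (σ₀ - δ) σ₀, m s = γ₁ s) (hright : ∀ s ∈ Ioo σ₁ (σ₁ + δ), m s = γ₂ s) :
    g.IsFutureCausalCurveOn τ
      (CausalCurveGluing.glueAt σ₀ γ₁ (CausalCurveGluing.glueAt σ₁ m γ₂)) (Icc a b) := by
  intro s hs
  set Γ := CausalCurveGluing.glueAt σ₀ γ₁ (CausalCurveGluing.glueAt σ₁ m γ₂) with hΓ
  rcases lt_or_ge s σ₀ with hlt | hge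
  · -- left of `σ₀`: `Γ = γ₁` near `s`
    have hev : Γ =ᶠ[𝓝 s] γ₁ := CausalCurveGluing.glueAt_eventuallyEq_left _ _ hlt
    obtain ⟨hd, hfd⟩ := h₁ s ⟨hs.1, hlt.le⟩
    refine ⟨hev.mdifferentiableAt_iff.mpr hd, ?_⟩
    have hv : velocity I Γ s = velocity I γ₁ s := by unfold velocity; rw [hev.mfderiv_eq]; rfl
    exact (isFutureDirected_congr_point hev.eq_of_nhds hv).mpr hfd
  rcases le_or_gt s σ₁ with hle | hgt
  · -- on `[σ₀, σ₁]`: `Γ = m` near `s`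
    have hev : Γ =ᶠ[𝓝 s] m := by
      have hI : Ioo (σ₀ - δ) (σ₁ + δ) ∈ 𝓝 s := Ioo_mem_nhds (by linarith) (by linarith)
      filter_upwards [hI] with s' hs'
      rcases le_or_gt s' σ₀ with h1 | h1
      · rw [hΓ, CausalCurveGluing.glueAt_of_le h1]
        exact (hleft s' ⟨hs'.1, h1⟩).symm
      rcases le_or_gt s' σ₁ with h2 | h2
      · rw [hΓ, CausalCurveGluing.glueAt_of_lt h1, CausalCurveGluing.glueAt_of_le h2]
      · rw [hΓ, CausalCurveGluing.glueAt_of_lt h1, CausalCurveGluing.glueAt_of_lt h2]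
        exact (hright s' ⟨h2, hs'.2⟩).symm
    obtain ⟨hd, hfd⟩ := hm s ⟨hge, hle⟩
    refine ⟨hev.mdifferentiableAt_iff.mpr hd, ?_⟩
    have hv : velocity I Γ s = velocity I m s := by unfold velocity; rw [hev.mfderiv_eq]; rfl
    exact (isFutureDirected_congr_point hev.eq_of_nhds hv).mpr hfd
  · -- right of `σ₁`: `Γ = γ₂` near `s`
    have hev : Γ =ᶠ[𝓝 s] γ₂ :=
      (CausalCurveGluing.glueAt_eventuallyEq_right _ _ (lt_of_le_of_lt hσ hgt)).trans
        (CausalCurveGluing.glueAt_eventuallyEq_right _ _ hgt)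
    obtain ⟨hd, hfd⟩ := h₂ s ⟨hgt.le, hs.2⟩
    refine ⟨hev.mdifferentiableAt_iff.mpr hd, ?_⟩
    have hv : velocity I Γ s = velocity I γ₂ s := by unfold velocity; rw [hev.mfderiv_eq]; rfl
    exact (isFutureDirected_congr_point hev.eq_of_nhds hv).mpr hfd

end LorentzianMetric

/-! ### The corner-rounding theorem and transitivity of `J⁺` -/

universe u₁ u₂ u₃

namespace LorentzianMetric

variable {g : LorentzianMetric I n M} {τ : TimeOrientation g}

/-- **Concatenation of causal curves with rounded corner.** On a manifold without boundary with a
`C¹` time-oriented Lorentzian metric, if a future causal curve `γ₁ : [a₁, b₁] → M` ends where a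
future causal curve `γ₂ : [a₂, b₂] → M` starts, then some future causal curve (differentiable at
every parameter, as `IsFutureCausalCurveOn` demands) runs from `γ₁ a₁` to `γ₂ b₂`. If the two
velocities at the junction are proportional, an affine reparametrisation of `γ₂` makes the
concatenation differentiable; otherwise their sum is future timelike (reverse Cauchy–Schwarz) and,
in the chart at the junction, the corner is replaced by a transition–bridge–transition arc
(`CausalCurveGluing.corner_rounding_coord`). This is the rounding-off of corners which O'Neill's
piecewise smooth causal curves make unnecessary (O'Neill 1983, Ch. 1, following Def. 1.17 (piecewise smooth curve
segments) and Ch. 5, p. 146: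
causal curves are piecewise smooth and do not switch causal cones at breaks; Ch. 10, Lemma 10.45–
Prop. 10.46 for the deformation technique). [cite: ONeillSemiRiemannian1983, Ch. 14, p. 402 and Ch. 10, Prop. 10.46] -/
theorem exists_isFutureCausalCurveOn_trans [BoundarylessManifold I M] (hn : 1 ≤ n)
    {γ₁ γ₂ : ℝ → M} {a₁ b₁ a₂ b₂ : ℝ} (hab₁ : a₁ < b₁) (hab₂ : a₂ < b₂)
    (hγ₁ : g.IsFutureCausalCurveOn τ γ₁ (Icc a₁ b₁)) (hγ₂ : g.IsFutureCausalCurveOn τ γ₂ (Icc a₂ b₂))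
    (hjoin : γ₁ b₁ = γ₂ a₂) :
    ∃ (γ : ℝ → M) (a b : ℝ), a < b ∧ g.IsFutureCausalCurveOn τ γ (Icc a b) ∧
      γ a = γ₁ a₁ ∧ γ b = γ₂ b₂ := by
  -- the junction point and its chart
  set p : M := γ₁ b₁ with hpdef
  set φ := extChartAt I p with hφ
  set x₀ : E := φ p with hx₀def
  have hps : p ∈ (chartAt H p).source := mem_chart_source H p
  have hx₀t : x₀ ∈ φ.target := (extChartAt I p).map_source (mem_extChartAt_source p)
  have hx₀p : φ.symm x₀ = p := (extChartAt I p).left_inv (mem_extChartAt_source p)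
  -- a ball of the model space inside the chart target (no boundary)
  obtain ⟨R, hR, hballR⟩ : ∃ R : ℝ, 0 < R ∧ Metric.ball x₀ R ⊆ φ.target := by
    have hint : x₀ ∈ interior φ.target :=
      ModelWithCorners.isInteriorPoint_iff.mp (BoundarylessManifold.isInteriorPoint (I := I))
    exact Metric.mem_nhds_iff.mp (mem_interior_iff_mem_nhds.mp hint)
  have hballR' : ∀ x : E, ‖x - x₀‖ < R → x ∈ φ.target :=
    fun x hx ↦ hballR (by rwa [Metric.mem_ball, dist_eq_norm])
  have htn : ∀ x : E, ‖x - x₀‖ < R → φ.target ∈ 𝓝 x := fun x hx ↦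
    Filter.mem_of_superset (Metric.isOpen_ball.mem_nhds (by rwa [Metric.mem_ball, dist_eq_norm]))
      hballR
  -- the metric and the time orientation in coordinates
  set G : E → E →L[ℝ] E →L[ℝ] ℝ := g.coordMetric p with hGdef
  set Tc : E → E := τ.coordTime p with hTcdef
  have hGcd : ContDiffOn ℝ 1 G φ.target := g.contDiffOn_coordMetric hn p
  have hGd : ∀ x, ‖x - x₀‖ < R → DifferentiableAt ℝ G x := fun x hx ↦
    ((hGcd.differentiableOn one_ne_zero) x (hballR' x hx)).differentiableAt (htn x hx)
  have hTc : ∀ x, ‖x - x₀‖ < R → ContinuousAt (fun x ↦ G x (Tc x)) x := fun x hx ↦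
    ((hGcd.continuousOn.clm_apply (τ.continuousOn_coordTime hn p)) x (hballR' x hx)).continuousAt
      (htn x hx)
  have hsymm : ∀ x, ‖x - x₀‖ < R → ∀ v w, G x v w = G x w v :=
    fun x hx v w ↦ g.coordMetric_comm (hballR' x hx) v w
  -- the timecone inequality, transported to coordinates
  have hcone : ∀ x, ‖x - x₀‖ < R → ∀ v w, G x v v ≤ 0 → v ≠ 0 → G x (Tc x) v < 0 →
      G x w w < 0 → G x (Tc x) w < 0 → G x v w < 0 := by
    intro x hx v w hvv hv0 hvf hww hwf
    have hxt := hballR' x hx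
    have hw0 : w ≠ 0 := fun h ↦ by rw [h, map_zero] at hwf; exact lt_irrefl 0 hwf
    have hv : τ.IsFutureDirected _ := (isFutureDirected_symmL_iff (τ := τ) hxt v).mpr ⟨⟨hvv, hv0⟩, hvf⟩
    have hw : τ.IsFutureDirected _ :=
      (isFutureDirected_symmL_iff (τ := τ) hxt w).mpr ⟨⟨hww.le, hw0⟩, hwf⟩
    have hwt : g.IsTimelike _ := (isTimelike_symmL_iff (g := g) hxt w).mpr hww
    have key := hw.val_lt_zero τ hwt hv
    rw [g.symm] at key
    rwa [← g.coordMetric_apply hxt v w] at key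
  -- a neighbourhood of the junction which the chart maps into the ball
  set N : Set M := φ.source ∩ φ ⁻¹' Metric.ball x₀ R with hNdef
  have hN : N ∈ 𝓝 p := Filter.inter_mem (extChartAt_source_mem_nhds p)
    ((continuousAt_extChartAt p).preimage_mem_nhds
      (Metric.isOpen_ball.mem_nhds (Metric.mem_ball_self hR)))
  have hNs : ∀ y ∈ N, y ∈ (chartAt H p).source := fun y hy ↦ by
    rw [← extChartAt_source I p]; exact hy.1
  have hNb : ∀ y ∈ N, ‖φ y - x₀‖ < R := fun y hy ↦ by
    have := hy.2; rwa [mem_preimage, Metric.mem_ball, dist_eq_norm] at this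
  -- continuity of `γ₁` at `b₁` and of `γ₂` at `a₂`
  have hc₁b : ContinuousAt γ₁ b₁ := (hγ₁ b₁ ⟨hab₁.le, le_rfl⟩).1.continuousAt
  have hc₂a : ContinuousAt γ₂ a₂ := (hγ₂ a₂ ⟨le_rfl, hab₂.le⟩).1.continuousAt
  obtain ⟨d₁, hd₁, hd₁N⟩ : ∃ d : ℝ, 0 < d ∧ ∀ t, |t - b₁| < d → γ₁ t ∈ N := by
    have := hc₁b.preimage_mem_nhds hN
    rw [Metric.mem_nhds_iff] at this
    obtain ⟨d, hd, h⟩ := this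
    exact ⟨d, hd, fun t ht ↦ h (by rwa [Metric.mem_ball, Real.dist_eq])⟩
  obtain ⟨d₂, hd₂, hd₂N⟩ : ∃ d : ℝ, 0 < d ∧ ∀ t, |t - a₂| < d → γ₂ t ∈ N := by
    have hN' : N ∈ 𝓝 (γ₂ a₂) := by rwa [← hjoin]
    have := hc₂a.preimage_mem_nhds hN'
    rw [Metric.mem_nhds_iff] at this
    obtain ⟨d, hd, h⟩ := this
    exact ⟨d, hd, fun t ht ↦ h (by rwa [Metric.mem_ball, Real.dist_eq])⟩
  -- the scale `δ₀`
  obtain ⟨δ₀, hδ₀, hδ₀1, hδ₀2, hδ₀3, hδ₀4⟩ : ∃ δ : ℝ, 0 < δ ∧ 2 * δ ≤ d₁ ∧ 2 * δ ≤ d₂ ∧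
      2 * δ ≤ b₁ - a₁ ∧ 2 * δ ≤ b₂ - a₂ := by
    refine ⟨min (min (d₁ / 2) (d₂ / 2)) (min ((b₁ - a₁) / 2) ((b₂ - a₂) / 2)),
      lt_min (lt_min (by positivity) (by positivity)) (lt_min (by linarith) (by linarith)),
      ?_, ?_, ?_, ?_⟩
    · have := (min_le_left _ _).trans (min_le_left (d₁ / 2) (d₂ / 2))
        (a := min (min (d₁ / 2) (d₂ / 2)) (min ((b₁ - a₁) / 2) ((b₂ - a₂) / 2)))
      linarith
    · have := (min_le_left _ _).trans (min_le_right (d₁ / 2) (d₂ / 2))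
        (a := min (min (d₁ / 2) (d₂ / 2)) (min ((b₁ - a₁) / 2) ((b₂ - a₂) / 2)))
      linarith
    · have := (min_le_right _ _).trans (min_le_left ((b₁ - a₁) / 2) ((b₂ - a₂) / 2))
        (a := min (min (d₁ / 2) (d₂ / 2)) (min ((b₁ - a₁) / 2) ((b₂ - a₂) / 2)))
      linarith
    · have := (min_le_right _ _).trans (min_le_right ((b₁ - a₁) / 2) ((b₂ - a₂) / 2))
        (a := min (min (d₁ / 2) (d₂ / 2)) (min ((b₁ - a₁) / 2) ((b₂ - a₂) / 2)))
      linarith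
  have hγ₁N : ∀ s, |s| < 2 * δ₀ → γ₁ (s + b₁) ∈ N := fun s hs ↦
    hd₁N _ (by rw [add_sub_cancel_right]; linarith)
  have hγ₂N : ∀ s, |s| < 2 * δ₀ → γ₂ (s + a₂) ∈ N := fun s hs ↦
    hd₂N _ (by rw [add_sub_cancel_right]; linarith)
  -- the two curves in coordinates, parametrised so that the corner is at `0`
  set c₁ : ℝ → E := fun s ↦ φ (γ₁ (s + b₁)) with hc₁def
  set u₁ : ℝ → E := fun s ↦ (trivializationAt E (TangentSpace I) p).continuousLinearMapAt ℝ
    (γ₁ (s + b₁)) (velocity I γ₁ (s + b₁)) with hu₁def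
  set c₂ : ℝ → E := fun s ↦ φ (γ₂ (s + a₂)) with hc₂def
  set u₂ : ℝ → E := fun s ↦ (trivializationAt E (TangentSpace I) p).continuousLinearMapAt ℝ
    (γ₂ (s + a₂)) (velocity I γ₂ (s + a₂)) with hu₂def
  have hc₁ : ∀ s ∈ Icc (-δ₀) 0, HasDerivAt c₁ (u₁ s) s ∧ ‖c₁ s - x₀‖ < R ∧
      (G (c₁ s) (u₁ s) (u₁ s) ≤ 0 ∧ u₁ s ≠ 0) ∧ G (c₁ s) (Tc (c₁ s)) (u₁ s) < 0 := by
    intro s hs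
    have hyN : γ₁ (s + b₁) ∈ N := hγ₁N s (by rw [abs_lt]; constructor <;> linarith [hs.1, hs.2])
    have hy := hNs _ hyN
    obtain ⟨hmd, hfd⟩ := hγ₁ (s + b₁) ⟨by linarith [hs.1], by linarith [hs.2]⟩
    exact ⟨(hasDerivAt_extChartAt_comp_continuousLinearMapAt (p := p) hmd hy).comp_add_const s b₁, hNb _ hyN,
      (isFutureDirected_iff_coord hy _).mp hfd⟩
  have hc₂ : ∀ s ∈ Icc 0 δ₀, HasDerivAt c₂ (u₂ s) s ∧ ‖c₂ s - x₀‖ < R ∧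
      (G (c₂ s) (u₂ s) (u₂ s) ≤ 0 ∧ u₂ s ≠ 0) ∧ G (c₂ s) (Tc (c₂ s)) (u₂ s) < 0 := by
    intro s hs
    have hyN : γ₂ (s + a₂) ∈ N := hγ₂N s (by rw [abs_lt]; constructor <;> linarith [hs.1, hs.2])
    have hy := hNs _ hyN
    obtain ⟨hmd, hfd⟩ := hγ₂ (s + a₂) ⟨by linarith [hs.1], by linarith [hs.2]⟩
    exact ⟨(hasDerivAt_extChartAt_comp_continuousLinearMapAt (p := p) hmd hy).comp_add_const s a₂, hNb _ hyN,
      (isFutureDirected_iff_coord hy _).mp hfd⟩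
  have h₁0 : c₁ 0 = x₀ := by simp [hc₁def, hx₀def, hpdef]
  have h₂0 : c₂ 0 = x₀ := by
    show φ (γ₂ (0 + a₂)) = φ p
    rw [zero_add, ← hjoin]
  -- the velocities at the corner, in coordinates and pulled back to `T_p M`
  obtain ⟨-, -, ⟨hv₁c, hv₁0⟩, hv₁f⟩ := hc₁ 0 ⟨by linarith, le_rfl⟩
  obtain ⟨-, -, ⟨hv₂c, hv₂0⟩, hv₂f⟩ := hc₂ 0 ⟨le_rfl, hδ₀.le⟩
  rw [h₁0] at hv₁c hv₁f
  rw [h₂0] at hv₂c hv₂f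
  set ψ := (trivializationAt E (TangentSpace I) p).symmL ℝ (φ.symm x₀) with hψ
  have hw₁ : τ.IsFutureDirected (ψ (u₁ 0)) :=
    (isFutureDirected_symmL_iff (τ := τ) hx₀t (u₁ 0)).mpr ⟨⟨hv₁c, hv₁0⟩, hv₁f⟩
  have hw₂ : τ.IsFutureDirected (ψ (u₂ 0)) :=
    (isFutureDirected_symmL_iff (τ := τ) hx₀t (u₂ 0)).mpr ⟨⟨hv₂c, hv₂0⟩, hv₂f⟩
  -- the reparametrised first curve
  have hγ₁' : g.IsFutureCausalCurveOn τ (fun s ↦ γ₁ (s + b₁)) (Icc (a₁ - b₁) 0) := by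
    have := hγ₁.comp_add_const b₁; rwa [sub_self] at this
  by_cases hpar : ∃ c : ℝ, 0 < c ∧ u₂ 0 = c • u₁ 0
  · /- **Proportional velocities**: reparametrise `γ₂` affinely so that the two velocities at the
    junction agree; the concatenation is then differentiable at the junction. -/
    obtain ⟨c, hc, hcu⟩ := hpar
    -- the coordinate curve through the junction
    set ĉ : ℝ → E := CausalCurveGluing.glueAt 0 c₁ (fun s ↦ c₂ (s / c)) with hĉ
    have hĉd : HasDerivAt ĉ (u₁ 0) 0 := by
      refine CausalCurveGluing.hasDerivAt_glueAt (hc₁ 0 ⟨by linarith, le_rfl⟩).1 ?_ ?_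
      · have hd₂ : HasDerivAt c₂ (u₂ 0) (0 / c) := by rw [zero_div]; exact (hc₂ 0 ⟨le_rfl, hδ₀.le⟩).1
        have h := hd₂.scomp (0 : ℝ) ((hasDerivAt_id (0 : ℝ)).div_const c)
        refine h.congr_deriv ?_
        rw [hcu, smul_smul, one_div, inv_mul_cancel₀ hc.ne', one_smul]
      · simp only [zero_div, h₁0, h₂0]
    have hm : g.IsFutureCausalCurveOn τ (φ.symm ∘ ĉ) (Icc 0 0) := by
      refine isFutureCausalCurveOn_extChartAt_symm_comp (U := Metric.ball x₀ R)
        Metric.isOpen_ball hballR (u := fun _ ↦ u₁ 0) fun s hs ↦ ?_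
      have hs0 : s = 0 := le_antisymm hs.2 hs.1
      subst hs0
      have hĉ0 : ĉ 0 = x₀ := by rw [hĉ, CausalCurveGluing.glueAt_of_le le_rfl, h₁0]
      refine ⟨hĉd, ?_, ?_⟩
      · rw [hĉ0]; exact Metric.mem_ball_self hR
      · rw [hĉ0]; exact ⟨⟨hv₁c, hv₁0⟩, hv₁f⟩
    -- the reparametrised second curve
    have hγ₂' : g.IsFutureCausalCurveOn τ (fun s ↦ γ₂ (a₂ + s / c)) (Icc 0 (c * (b₂ - a₂))) := by
      refine hγ₂.comp_affine a₂ hc fun s hs ↦ ⟨?_, ?_⟩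
      · have : 0 ≤ s / c := div_nonneg hs.1 hc.le
        linarith
      · have : s / c ≤ b₂ - a₂ := by rw [div_le_iff₀ hc]; linarith [hs.2]
        linarith
    -- glue
    set δM := min δ₀ (c * δ₀) with hδM
    have hδM0 : 0 < δM := lt_min hδ₀ (mul_pos hc hδ₀)
    have hΓ := IsFutureCausalCurveOn.glue (σ₀ := 0) (σ₁ := 0) le_rfl hδM0 hγ₁' hm hγ₂'
      (fun s hs ↦ by
        have hsN : |s| < 2 * δ₀ := by
          rw [abs_lt]; constructor <;> linarith [hs.1, hs.2, min_le_left δ₀ (c * δ₀)]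
        show φ.symm (ĉ s) = γ₁ (s + b₁)
        rw [hĉ, CausalCurveGluing.glueAt_of_le hs.2]
        exact (extChartAt I p).left_inv (hγ₁N s hsN).1)
      (fun s hs ↦ by
        have hsc : |s / c| < 2 * δ₀ := by
          rw [abs_of_pos (div_pos hs.1 hc), div_lt_iff₀ hc]
          have := min_le_right δ₀ (c * δ₀)
          nlinarith [hs.2, this, hδ₀, hc]
        show φ.symm (ĉ s) = γ₂ (a₂ + s / c)
        rw [hĉ, CausalCurveGluing.glueAt_of_lt hs.1, add_comm a₂]
        exact (extChartAt I p).left_inv (hγ₂N (s / c) hsc).1)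
    refine ⟨_, a₁ - b₁, c * (b₂ - a₂), by nlinarith [mul_pos hc (sub_pos.mpr hab₂)], hΓ, ?_, ?_⟩
    · rw [CausalCurveGluing.glueAt_of_le (by linarith)]
      show γ₁ (a₁ - b₁ + b₁) = γ₁ a₁
      rw [sub_add_cancel]
    · have hpos : 0 < c * (b₂ - a₂) := mul_pos hc (sub_pos.mpr hab₂)
      rw [CausalCurveGluing.glueAt_of_lt hpos, CausalCurveGluing.glueAt_of_lt hpos]
      show γ₂ (a₂ + c * (b₂ - a₂) / c) = γ₂ b₂
      congr 1; field_simp; ring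
  · /- **Non-proportional velocities**: their sum is future timelike; round the corner in the
    chart. -/
    have hne : ¬ ∃ c : ℝ, 0 < c ∧ ψ (u₂ 0) = c • ψ (u₁ 0) := by
      rintro ⟨c, hc, hcψ⟩
      refine hpar ⟨c, hc, ?_⟩
      have hb : φ.symm x₀ ∈ (trivializationAt E (TangentSpace I) p).baseSet := by
        rw [hx₀p]; simp
      have h1 := congrArg ((trivializationAt E (TangentSpace I) p).continuousLinearMapAt ℝ
        (φ.symm x₀)) hcψ
      rwa [map_smul, hψ, Trivialization.continuousLinearMapAt_symmL _ hb,
        Trivialization.continuousLinearMapAt_symmL _ hb] at h1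
    have hDt : g.IsTimelike (ψ (u₁ 0) + ψ (u₂ 0)) := hw₁.isTimelike_add hw₂ hne
    have hDf : τ.IsFutureDirected (ψ (u₁ 0) + ψ (u₂ 0)) := hw₁.add τ hw₂
    rw [← map_add] at hDt hDf
    have hD : G x₀ (u₁ 0 + u₂ 0) (u₁ 0 + u₂ 0) < 0 := (isTimelike_symmL_iff (g := g) hx₀t _).mp hDt
    have hTD : G x₀ (Tc x₀) (u₁ 0 + u₂ 0) < 0 :=
      ((isFutureDirected_symmL_iff (τ := τ) hx₀t _).mp hDf).2
    -- round the corner in coordinates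
    obtain ⟨ε, s₄, hε0, -, hεδ₀, hεs₄, ĉ, û, hgood, hleftc, hrightc⟩ :=
      CausalCurveGluing.corner_rounding_coord (ε₁ := δ₀) hR hδ₀ hδ₀ hGd hTc hsymm hcone hc₁ hc₂
        h₁0 h₂0 hD hTD
    -- the middle piece is a causal curve
    have hm : g.IsFutureCausalCurveOn τ (φ.symm ∘ ĉ) (Icc (-ε) s₄) :=
      isFutureCausalCurveOn_extChartAt_symm_comp (U := Metric.ball x₀ R) Metric.isOpen_ball hballR
        fun s hs ↦ by
          obtain ⟨hd, hb, hcs⟩ := hgood s hs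
          exact ⟨hd, by rwa [Metric.mem_ball, dist_eq_norm], hcs⟩
    -- the reparametrised second curve
    have hγ₂' : g.IsFutureCausalCurveOn τ (fun s ↦ γ₂ (s + (a₂ + ε - s₄)))
        (Icc s₄ (s₄ + (b₂ - a₂ - ε))) := by
      refine (hγ₂.comp_add_const (a₂ + ε - s₄)).mono (Icc_subset_Icc (by linarith) (by linarith))
    -- glue
    have hΓ := IsFutureCausalCurveOn.glue (σ₀ := -ε) (σ₁ := s₄) hεs₄.le hδ₀
      (hγ₁'.mono (Icc_subset_Icc le_rfl (by linarith))) hm hγ₂'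
      (fun s hs ↦ by
        have hsN : |s| < 2 * δ₀ := by rw [abs_lt]; constructor <;> linarith [hs.1, hs.2]
        show φ.symm (ĉ s) = γ₁ (s + b₁)
        rw [hleftc s hs.2]
        exact (extChartAt I p).left_inv (hγ₁N s hsN).1)
      (fun s hs ↦ by
        have hsN : |s - s₄ + ε| < 2 * δ₀ := by
          rw [abs_lt]; constructor <;> linarith [hs.1, hs.2]
        show φ.symm (ĉ s) = γ₂ (s + (a₂ + ε - s₄))
        rw [hrightc s hs.1.le, show s + (a₂ + ε - s₄) = (s - s₄ + ε) + a₂ by ring]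
        exact (extChartAt I p).left_inv (hγ₂N _ hsN).1)
    refine ⟨_, a₁ - b₁, s₄ + (b₂ - a₂ - ε), by linarith, hΓ, ?_, ?_⟩
    · rw [CausalCurveGluing.glueAt_of_le (by linarith)]
      show γ₁ (a₁ - b₁ + b₁) = γ₁ a₁
      rw [sub_add_cancel]
    · rw [CausalCurveGluing.glueAt_of_lt (by linarith), CausalCurveGluing.glueAt_of_lt (by linarith)]
      show γ₂ (s₄ + (b₂ - a₂ - ε) + (a₂ + ε - s₄)) = γ₂ b₂
      congr 1; ring

/-- **Transitivity of the causal relation** (faithful restatement of `causalFuture_trans`):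
on a manifold *without boundary* carrying a `C²` time-oriented Lorentzian metric,
`J⁺(J⁺(S)) = J⁺(S)` for every `S ⊆ M`. O'Neill 1983, Ch. 14, p. 402: "The relations defined above
are transitive" — there causal curves are *piecewise* smooth (Ch. 1, following Def. 1.17; Ch. 5, p. 146), so
that transitivity is mere concatenation; for the everywhere-differentiable causal curves of
`IsFutureCausalCurveOn` the corner at the junction has to be rounded off
(`exists_isFutureCausalCurveOn_trans`). The statement quantifies internally over the manifold, the
metric and the time orientation, so that it is a *closed* named fact (discharged by
`causalFuture_causalFuture_holds : causalFuture_causalFuture`); instantiate it as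
`causalFuture_causalFuture_holds g τ hn S`.

**Discrepancy with `causalFuture_trans`.** That `def` sits in a section with the standing
variables `[FiniteDimensional ℝ E] [T2Space M] [BoundarylessManifold I M]`, but instance-implicit
section variables which the body does not mention are not captured by a `def`: as declared,
`causalFuture_trans` quantifies over manifolds *with* boundary and corners modelled on arbitrary
(merely convex) model ranges in arbitrary normed spaces — beyond the cited source, whose manifolds
are finite-dimensional, Hausdorff and without boundary, and beyond what corner rounding gives (at
a boundary point of a strictly convex model range the rounded arc may leave the range). Here the
no-boundary hypothesis — the only one the proof uses; finite dimension and the Hausdorff property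
are not needed — is part of the statement, together with the `2 ≤ n` of the original (the proof
uses `1 ≤ n`). [cite: ONeillSemiRiemannian1983, Ch. 14, p. 402] -/
def causalFuture_causalFuture : Prop :=
  ∀ {E' : Type u₁} [NormedAddCommGroup E'] [NormedSpace ℝ E'] {H' : Type u₂} [TopologicalSpace H']
    {I' : ModelWithCorners ℝ E' H'} {n' : ℕ∞ω} {M' : Type u₃} [TopologicalSpace M']
    [ChartedSpace H' M'] [IsManifold I' ∞ M'] (g' : LorentzianMetric I' n' M')
    (τ' : TimeOrientation g') [BoundarylessManifold I' M'] (_ : 2 ≤ n') (S : Set M'),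
    g'.causalFuture τ' (g'.causalFuture τ' S) = g'.causalFuture τ' S

/-- **Discharge of `causalFuture_causalFuture`**: `J⁺(J⁺(S)) = J⁺(S)` on a manifold without
boundary with a `C²` (indeed `C¹` suffices) time-oriented Lorentzian metric. `⊇` is
`S ⊆ J⁺(S)`; for `⊆`, a point reached from `J⁺(S)` by a causal curve is reached from `S` by the
concatenation with rounded corner of `exists_isFutureCausalCurveOn_trans`. O'Neill 1983, Ch. 14,
p. 402. [cite: ONeillSemiRiemannian1983, Ch. 14, p. 402] -/
theorem causalFuture_causalFuture_holds : causalFuture_causalFuture := by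
  intro E' _ _ H' _ I' n' M' _ _ _ g' τ' _ hn S
  refine Subset.antisymm ?_ (subset_causalFuture g' τ' _)
  rintro q (hq | ⟨p₁, hp₁, γ₂, a₂, b₂, hab₂, hγ₂, hpa, hqb⟩)
  · exact hq
  rcases hp₁ with hp₁S | ⟨p₀, hp₀, γ₁, a₁, b₁, hab₁, hγ₁, hp₀a, hp₁b⟩
  · exact Or.inr ⟨p₁, hp₁S, γ₂, a₂, b₂, hab₂, hγ₂, hpa, hqb⟩
  · have hn1 : (1 : ℕ∞ω) ≤ n' := le_trans (by norm_num) hn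
    obtain ⟨γ, a, b, hab, hγ, hγa, hγb⟩ :=
      exists_isFutureCausalCurveOn_trans hn1 hab₁ hab₂ hγ₁ hγ₂ (hp₁b.trans hpa.symm)
    exact Or.inr ⟨p₀, hp₀, γ, a, b, hab, hγ, hγa.trans hp₀a, hγb.trans hqb⟩

/-- The instance of `causalFuture_causalFuture_holds` for the metric and time orientation at hand:
`J⁺(J⁺(S)) = J⁺(S)`. O'Neill 1983, Ch. 14, p. 402. [cite: ONeillSemiRiemannian1983, Ch. 14, p. 402] -/
theorem causalFuture_causalFuture_eq [BoundarylessManifold I M] (hn : 2 ≤ n) (S : Set M) :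
    g.causalFuture τ (g.causalFuture τ S) = g.causalFuture τ S :=
  causalFuture_causalFuture_holds g τ hn S

/-- **Restricted discharge of the original `causalFuture_trans`** on manifolds without boundary:
a consumer `(h : g.causalFuture_trans τ)` working on a boundaryless manifold is fed this term
(the unrestricted `causalFuture_trans` is mis-scoped, see `causalFuture_causalFuture`).
O'Neill 1983, Ch. 14, p. 402. [cite: ONeillSemiRiemannian1983, Ch. 14, p. 402] -/
theorem causalFuture_trans_of_boundarylessManifold [BoundarylessManifold I M] :
    g.causalFuture_trans τ :=
  fun hn S ↦ causalFuture_causalFuture_eq hn S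

end LorentzianMetric

end Literature.Geometry.Lorentzian

end
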